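import Literature.NumberTheory.Automorphic.QuadraticOrderPicardForms
import Literature.NumberTheory.Automorphic.QuadraticOrderUnitIndex
import Literature.NumberTheory.Automorphic.HeckeTraceFormulaGL2LevelPrimeDifference
import HarnessLib

/-!
# The orders through `γ`: conductors `f ∈ ellipticConductors t n`

Topic `NumberTheory/Automorphic`; definitions and theorems only (no named fact, no `sorry`).
Twelfth brick of the Brandt-module side of the Eichler–Pizer trace identity.

For `t ∈ ℤ`, `n ∈ ℕ` with `t² < 4n` the Eichler–Selberg conductor set
`ellipticConductors t n = {f ≥ 1 : f² ∣ t² - 4n, (t² - 4n)/f² ≡ 0, 1 (4)}` is the set of divisors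
of its largest element, the **conductor** `F` (`ellipticConductors_eq_divisors`); there is a
**shift** `k ∈ ℤ` with `F ∣ t + 2k`, `F² ∣ k² + tk + n`, and for `f ∣ F` we put
`t_f = (t + 2k)/f`, `n_f = (k² + tk + n)/f²` (`tOf`, `nOf`; `t_f² - 4 n_f = (t² - 4n)/f²`).

For `γ` in a division quaternion algebra `D` over `ℚ` with `trd γ = t`, `nrd γ = n`
(`GammaHyp`), the element `σ_f = (γ + k)/f` satisfies `σ_f² = t_f σ_f - n_f`, and
`B_f = ℤ[σ_f] = [1, σ_f]` (`ordOf`) is an order of `ℚ(γ)` through `γ` of discriminant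
`(t² - 4n)/f²`; `f ↦ B_f` is a bijection from `ellipticConductors t n` onto the orders of `ℚ(γ)`
containing `γ` (`exists_eq_ordOf`, `ordOf_injective`), increasing (`ordOf_mono`), with
`B_f ⊂ B_{fq}` a step of index `q` in the sense of `StepHyp` (`stepHyp_ordOf`), and `B_f` is
non-maximal at `q` iff `fq` is again a conductor (`nonmax_iff`).  Root counts:
`rho q t' n' = #{x mod q : x² - t'x + n' ≡ 0}`, `= 1` when `q ∣ t'² - 4n'`, invariant along the
chain `f ↦ fq'` for `q' ≠ q` (`rho_tOf_eq`), and `#{x mod q : q² ∣ x² - tx + n} = 1` for `q ∣ f`,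
`f` a conductor (`card_sq_dvd_eq_one`).

## References

* D. A. Cox, *Primes of the form x² + ny²*, 2nd ed. (2013), §7.A (orders, conductor, Lemma 7.2,
  (7.2)–(7.3)), [Cox2013].
* R. Schoof, M. van der Vlugt, *Hecke operators and the weight distributions of certain codes*,
  JCTA 57 (1991), Thm. 2.2 (the set of `f`), [SchoofVandervlugt1991].
-/

noncomputable section

open scoped Pointwise

universe u

namespace Literature.NumberTheory.Automorphic

open HeckeTraceFormulaGL2Level

namespace Brandt

/-! ### The conductor set -/

section Arith

variable {t : ℤ} {n : ℕ}

/-- `c² d ≡ 0, 1 (mod 4)` when `d ≡ 0, 1 (mod 4)`. [folklore] -/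
theorem sq_mul_emod_four (c d : ℤ) (hd : d % 4 = 0 ∨ d % 4 = 1) : c ^ 2 * d % 4 = 0 ∨ c ^ 2 * d % 4 = 1 := by
  rcases Int.even_or_odd c with ⟨r, rfl⟩ | ⟨r, rfl⟩
  · left; rw [show (r + r) ^ 2 * d = 4 * (r ^ 2 * d) by ring]; simp
  · rw [show (2 * r + 1) ^ 2 * d = d + 4 * ((r ^ 2 + r) * d) by ring, Int.add_mul_emod_self_left]; exact hd

/-- `c² d ≡ d (mod 4)` for odd `c`. [folklore] -/
theorem sq_mul_emod_four_of_odd {c : ℤ} (hc : Odd c) (d : ℤ) : c ^ 2 * d % 4 = d % 4 := by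
  obtain ⟨r, rfl⟩ := hc
  rw [show (2 * r + 1) ^ 2 * d = d + 4 * ((r ^ 2 + r) * d) by ring, Int.add_mul_emod_self_left]

/-- **Membership in the conductor set.** [cite: SchoofVandervlugt1991, Thm. 2.2 (A₂), p. 168] -/
theorem mem_ellipticConductors_iff (h : t ^ 2 < 4 * n) {f : ℕ} :
    f ∈ ellipticConductors t n ↔ 0 < f ∧ (f : ℤ) ^ 2 ∣ t ^ 2 - 4 * n ∧
      (((t ^ 2 - 4 * n) / (f : ℤ) ^ 2) % 4 = 0 ∨ ((t ^ 2 - 4 * n) / (f : ℤ) ^ 2) % 4 = 1) := by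
  unfold ellipticConductors
  rw [Finset.mem_filter, Nat.mem_divisors]
  have hN : ((4 * n - t ^ 2).toNat : ℤ) = 4 * n - t ^ 2 := Int.toNat_of_nonneg (by linarith)
  have hN0 : (4 * n - t ^ 2).toNat ≠ 0 := by
    intro h0; have := congrArg (fun x : ℕ => (x : ℤ)) h0; simp only [hN, Nat.cast_zero] at this; linarith
  constructor
  · rintro ⟨⟨hdvd, -⟩, hsq, hmod⟩
    refine ⟨Nat.pos_of_ne_zero ?_, hsq, hmod⟩
    rintro rfl; rw [zero_dvd_iff] at hdvd; exact hN0 hdvd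
  · rintro ⟨hf, hsq, hmod⟩
    refine ⟨⟨?_, hN0⟩, hsq, hmod⟩
    have h1 : (f : ℤ) ∣ 4 * n - t ^ 2 := by
      have : (f : ℤ) ∣ t ^ 2 - 4 * n := (dvd_pow_self (f : ℤ) two_ne_zero).trans hsq
      rw [← dvd_neg, neg_sub] at this; exact this
    rw [← hN] at h1
    exact_mod_cast h1

/-- `1` is a conductor (`t² - 4n ≡ 0, 1 (mod 4)`). [folklore] -/
theorem one_mem_ellipticConductors (h : t ^ 2 < 4 * n) : 1 ∈ ellipticConductors t n := by
  rw [mem_ellipticConductors_iff h]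
  refine ⟨one_pos, by simp, ?_⟩
  simp only [Nat.cast_one, one_pow, Int.ediv_one]
  have e : (t ^ 2 - 4 * n) % 4 = t ^ 2 % 4 := by
    rw [Int.sub_emod, Int.mul_emod_right, sub_zero, Int.emod_emod_of_dvd _ (dvd_refl _)]
  rw [e]; simpa using sq_mul_emod_four t 1 (Or.inr (by norm_num))

/-- Conductors are positive. [folklore] -/
theorem pos_of_mem_ellipticConductors (h : t ^ 2 < 4 * n) {f : ℕ} (hf : f ∈ ellipticConductors t n) : 0 < f :=
  ((mem_ellipticConductors_iff h).mp hf).1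

/-- **Divisors of conductors are conductors.** [cite: Cox2013, §7.A (orders containing an order)] -/
theorem dvd_mem_ellipticConductors (h : t ^ 2 < 4 * n) {f g : ℕ} (hf : f ∈ ellipticConductors t n)
    (hg : g ∣ f) : g ∈ ellipticConductors t n := by
  rw [mem_ellipticConductors_iff h] at hf ⊢
  obtain ⟨hf0, ⟨d, hd⟩, hmod⟩ := hf
  obtain ⟨c, rfl⟩ := hg
  have hg0 : 0 < g := Nat.pos_of_ne_zero fun h0 => by subst h0; simp at hf0
  have hgZ : ((g : ℤ)) ^ 2 ≠ 0 := pow_ne_zero 2 (by exact_mod_cast hg0.ne')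
  have hfZ : (((g * c : ℕ) : ℤ)) ^ 2 ≠ 0 := pow_ne_zero 2 (by exact_mod_cast hf0.ne')
  have hq : (t ^ 2 - 4 * n) / (((g * c : ℕ) : ℤ)) ^ 2 = d := by
    rw [hd, Int.mul_ediv_cancel_left _ hfZ]
  rw [hq] at hmod
  refine ⟨hg0, ⟨(c : ℤ) ^ 2 * d, by rw [hd]; push_cast; ring⟩, ?_⟩
  have hq' : (t ^ 2 - 4 * n) / ((g : ℤ)) ^ 2 = (c : ℤ) ^ 2 * d := by
    rw [hd, show (((g * c : ℕ) : ℤ)) ^ 2 * d = (g : ℤ) ^ 2 * ((c : ℤ) ^ 2 * d) by push_cast; ring,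
      Int.mul_ediv_cancel_left _ hgZ]
  rw [hq']
  exact sq_mul_emod_four _ _ hmod

/-- **Least common multiples of conductors are conductors.** [cite: Cox2013, §7.A (7.2)–(7.3)] -/
theorem lcm_mem_ellipticConductors (h : t ^ 2 < 4 * n) {f g : ℕ} (hf : f ∈ ellipticConductors t n)
    (hg : g ∈ ellipticConductors t n) : f.lcm g ∈ ellipticConductors t n := by
  rw [mem_ellipticConductors_iff h] at hf hg ⊢
  obtain ⟨hf0, hfd, hfmod⟩ := hf
  obtain ⟨hg0, hgd, hgmod⟩ := hg
  -- `f = g₀ a`, `g = g₀ b`, `a ⊥ b`, `lcm = g₀ a b`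
  set g₀ := f.gcd g with hg₀
  have hg₀0 : 0 < g₀ := Nat.gcd_pos_of_pos_left _ hf0
  obtain ⟨a, ha⟩ : g₀ ∣ f := Nat.gcd_dvd_left f g
  obtain ⟨b, hb⟩ : g₀ ∣ g := Nat.gcd_dvd_right f g
  have hab : a.Coprime b := by
    have := Nat.coprime_div_gcd_div_gcd (m := f) (n := g) hg₀0
    rw [← hg₀] at this
    rwa [ha, hb, Nat.mul_div_cancel_left _ hg₀0, Nat.mul_div_cancel_left _ hg₀0] at this
  have hL : f.lcm g = g₀ * a * b := by
    have h1 : f.gcd g * f.lcm g = f * g := Nat.gcd_mul_lcm f g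
    rw [← hg₀] at h1
    have h2 : g₀ * f.lcm g = g₀ * (g₀ * a * b) := by rw [h1, ha, hb]; ring
    exact Nat.eq_of_mul_eq_mul_left hg₀0 h2
  have ha0 : 0 < a := Nat.pos_of_ne_zero fun h0 => by rw [h0, mul_zero] at ha; omega
  have hb0 : 0 < b := Nat.pos_of_ne_zero fun h0 => by rw [h0, mul_zero] at hb; omega
  -- `L² ∣ Δ`
  obtain ⟨x, hx⟩ := hfd
  have hbx : ((b : ℤ)) ^ 2 ∣ x := by
    have h1 : ((g : ℤ)) ^ 2 ∣ ((f : ℤ)) ^ 2 * x := by rw [← hx]; exact hgd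
    rw [ha, hb] at h1; push_cast at h1
    rw [show ((g₀ : ℤ) * b) ^ 2 = (b : ℤ) ^ 2 * (g₀ : ℤ) ^ 2 by ring,
      show ((g₀ : ℤ) * a) ^ 2 * x = ((a : ℤ) ^ 2 * x) * (g₀ : ℤ) ^ 2 by ring] at h1
    have h2 : ((b : ℤ)) ^ 2 ∣ (a : ℤ) ^ 2 * x :=
      (mul_dvd_mul_iff_right (pow_ne_zero 2 (by exact_mod_cast hg₀0.ne'))).mp h1
    have hcop : IsCoprime ((b : ℤ) ^ 2) ((a : ℤ) ^ 2) := by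
      rw [Int.isCoprime_iff_gcd_eq_one, Int.gcd, Int.natAbs_pow, Int.natAbs_pow, Int.natAbs_natCast,
        Int.natAbs_natCast]
      exact (Nat.Coprime.pow 2 2 hab.symm)
    exact hcop.dvd_of_dvd_mul_left h2
  obtain ⟨y, rfl⟩ := hbx
  have hLZ : ((f.lcm g : ℕ) : ℤ) = (g₀ : ℤ) * a * b := by rw [hL]; push_cast; ring
  have hΔ : t ^ 2 - 4 * n = (((f.lcm g : ℕ) : ℤ)) ^ 2 * y := by rw [hx, hLZ, ha]; push_cast; ring
  have hL0 : (((f.lcm g : ℕ) : ℤ)) ^ 2 ≠ 0 := by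
    rw [hLZ]; exact pow_ne_zero 2 (by positivity)
  refine ⟨by rw [hL]; positivity, ⟨y, hΔ⟩, ?_⟩
  rw [hΔ, Int.mul_ediv_cancel_left _ hL0]
  -- `y ≡ Δ/f² (b odd)` or `y ≡ Δ/g² (a odd)`
  have hfq : (t ^ 2 - 4 * n) / ((f : ℤ)) ^ 2 = (b : ℤ) ^ 2 * y := by
    rw [hx, Int.mul_ediv_cancel_left _ (pow_ne_zero 2 (by exact_mod_cast hf0.ne'))]
  have hgq : (t ^ 2 - 4 * n) / ((g : ℤ)) ^ 2 = (a : ℤ) ^ 2 * y := by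
    rw [hΔ, hLZ, hb]; push_cast
    rw [show ((g₀ : ℤ) * a * b) ^ 2 * y = ((g₀ : ℤ) * b) ^ 2 * ((a : ℤ) ^ 2 * y) by ring,
      Int.mul_ediv_cancel_left _ (pow_ne_zero 2 (by positivity))]
  rw [hfq] at hfmod; rw [hgq] at hgmod
  rcases Nat.even_or_odd b with hbe | hbo
  · have hao : Odd a := by
      by_contra hae
      rw [Nat.not_odd_iff_even] at hae
      have h2 : 2 ∣ a.gcd b := Nat.dvd_gcd hae.two_dvd hbe.two_dvd
      rw [hab] at h2; omega
    have hao' : Odd (a : ℤ) := by exact_mod_cast hao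
    rwa [sq_mul_emod_four_of_odd hao'] at hgmod
  · have hbo' : Odd (b : ℤ) := by exact_mod_cast hbo
    rwa [sq_mul_emod_four_of_odd hbo'] at hfmod

/-- **The conductor** `F` of `(t, n)`: the least common multiple of the conductor set
(`t² - 4n = d_K F²`). [cite: Cox2013, §7.A (7.3)] -/
def conductor (t : ℤ) (n : ℕ) : ℕ := (ellipticConductors t n).lcm id

/-- The conductor is a conductor. [cite: Cox2013, §7.A (7.3)] -/
theorem conductor_mem (h : t ^ 2 < 4 * n) : conductor t n ∈ ellipticConductors t n := by
  classical
  unfold conductor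
  have key : ∀ s : Finset ℕ, s ⊆ ellipticConductors t n → s.lcm id ∈ ellipticConductors t n := by
    intro s
    induction s using Finset.induction_on with
    | empty => intro _; rw [Finset.lcm_empty]; exact one_mem_ellipticConductors h
    | insert a s ha ih =>
      intro hs
      rw [Finset.lcm_insert, id]
      exact lcm_mem_ellipticConductors h (hs (Finset.mem_insert_self _ _))
        (ih fun x hx => hs (Finset.mem_insert_of_mem hx))
  exact key _ subset_rfl

/-- Conductors divide the conductor. [cite: Cox2013, §7.A (7.3)] -/
theorem dvd_conductor {f : ℕ} (hf : f ∈ ellipticConductors t n) : f ∣ conductor t n := by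
  unfold conductor; exact Finset.dvd_lcm hf

/-- **`f` is a conductor iff `f ∣ F`.** [cite: Cox2013, §7.A (7.2)–(7.3)] -/
theorem mem_ellipticConductors_iff_dvd (h : t ^ 2 < 4 * n) {f : ℕ} :
    f ∈ ellipticConductors t n ↔ f ∣ conductor t n :=
  ⟨dvd_conductor, dvd_mem_ellipticConductors h (conductor_mem h)⟩

/-- The conductor is positive. [folklore] -/
theorem conductor_pos (h : t ^ 2 < 4 * n) : 0 < conductor t n :=
  pos_of_mem_ellipticConductors h (conductor_mem h)

/-- **The conductor set is the set of divisors of the conductor.** [cite: Cox2013, §7.A (7.2)–(7.3)] -/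
theorem ellipticConductors_eq_divisors (h : t ^ 2 < 4 * n) : ellipticConductors t n = (conductor t n).divisors := by
  ext f
  rw [mem_ellipticConductors_iff_dvd h, Nat.mem_divisors]
  exact ⟨fun hf => ⟨hf, (conductor_pos h).ne'⟩, fun hf => hf.1⟩

/-! ### The shift `k` and the data `t_f, n_f` -/

/-- **Existence of the shift**: a conductor `f` admits `k` with `f ∣ t + 2k` and
`f² ∣ k² + tk + n` (take `2k = f t_f - t` with `t_f ≡ (t² - 4n)/f² (mod 2)`). [cite: Cox2013, §7.A Lemma 7.2] -/
theorem exists_shift_of_mem (h : t ^ 2 < 4 * n) {f : ℕ} (hf : f ∈ ellipticConductors t n) :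
    ∃ k : ℤ, (f : ℤ) ∣ t + 2 * k ∧ (f : ℤ) ^ 2 ∣ k ^ 2 + t * k + n := by
  rw [mem_ellipticConductors_iff h] at hf
  obtain ⟨hf0, ⟨d, hd⟩, hmod⟩ := hf
  have hfZ : ((f : ℤ)) ^ 2 ≠ 0 := pow_ne_zero 2 (by exact_mod_cast hf0.ne')
  rw [hd, Int.mul_ediv_cancel_left _ hfZ] at hmod
  -- `d = 4e` or `d = 4e + 1`; `t_f := 0` or `1`
  obtain ⟨tf, e, hde⟩ : ∃ tf e : ℤ, d = 4 * e + tf ^ 2 ∧ (tf = 0 ∨ tf = 1) := by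
    rcases hmod with hm | hm
    · exact ⟨0, d / 4, by omega, Or.inl rfl⟩
    · exact ⟨1, d / 4, by omega, Or.inr rfl⟩
  obtain ⟨hde, htf⟩ := hde
  -- parity: `t ≡ f tf (mod 2)`
  have hpar : 2 ∣ (f : ℤ) * tf - t := by
    have h1 : t ^ 2 = (f : ℤ) ^ 2 * (4 * e) + ((f : ℤ) * tf) ^ 2 + 4 * n := by
      have := hd; rw [hde] at this; linear_combination this
    -- squares congruent mod 4 ⇒ same parity
    have h2 : 2 ∣ ((f : ℤ) * tf - t) * ((f : ℤ) * tf + t) := ⟨-(2 * (f : ℤ) ^ 2 * e + 2 * n), by linear_combination -h1⟩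
    rcases (Int.prime_two.dvd_or_dvd h2) with h3 | h3
    · exact h3
    · have : (f : ℤ) * tf - t = ((f : ℤ) * tf + t) - 2 * t := by ring
      rw [this]; exact dvd_sub h3 (dvd_mul_right 2 t)
  obtain ⟨k, hk⟩ := hpar
  refine ⟨k, ⟨tf, by linear_combination -hk⟩, ⟨-e, ?_⟩⟩
  -- `k² + tk + n = ((2k + t)² - Δ)/4 = (f² tf² - f² d)/4 = f² (tf² - d)/4 = -f² e`
  have h4 : 4 * (k ^ 2 + t * k + n) = 4 * ((f : ℤ) ^ 2 * (-e)) := by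
    have e1 : 2 * k = (f : ℤ) * tf - t := by linear_combination -hk
    have e2 : 4 * (k ^ 2 + t * k + n) = (2 * k + t) ^ 2 - (t ^ 2 - 4 * n) := by ring
    rw [e2, e1, hd, hde]; ring
  linarith

/-- **The shift** `k` of `(t, n)`: `F ∣ t + 2k`, `F² ∣ k² + tk + n` for the conductor `F`
(and `k = 0` in the degenerate case `t² ≥ 4n`). [cite: Cox2013, §7.A Lemma 7.2] -/
def shift (t : ℤ) (n : ℕ) : ℤ :=
  if h : t ^ 2 < 4 * n then (exists_shift_of_mem h (conductor_mem h)).choose else 0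

/-- The defining property of the shift. [cite: Cox2013, §7.A Lemma 7.2] -/
theorem conductor_dvd_shift (h : t ^ 2 < 4 * n) :
    ((conductor t n : ℕ) : ℤ) ∣ t + 2 * shift t n ∧
      ((conductor t n : ℕ) : ℤ) ^ 2 ∣ shift t n ^ 2 + t * shift t n + n := by
  unfold shift; rw [dif_pos h]; exact (exists_shift_of_mem h (conductor_mem h)).choose_spec

/-- A conductor `f` has `f ∣ t + 2k`, `f² ∣ k² + tk + n`. [cite: Cox2013, §7.A Lemma 7.2] -/
theorem dvd_shift (h : t ^ 2 < 4 * n) {f : ℕ} (hf : f ∈ ellipticConductors t n) :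
    (f : ℤ) ∣ t + 2 * shift t n ∧ (f : ℤ) ^ 2 ∣ shift t n ^ 2 + t * shift t n + n := by
  obtain ⟨h1, h2⟩ := conductor_dvd_shift h
  have hfF : (f : ℤ) ∣ (conductor t n : ℤ) := Int.natCast_dvd_natCast.mpr (dvd_conductor hf)
  exact ⟨hfF.trans h1, (pow_dvd_pow_of_dvd hfF 2).trans h2⟩

/-- **`t_f = (t + 2k)/f`**, the trace of `σ_f = (γ + k)/f`. [cite: Cox2013, §7.A Lemma 7.2] -/
def tOf (t : ℤ) (n : ℕ) (f : ℕ) : ℤ := (t + 2 * shift t n) / f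

/-- **`n_f = (k² + tk + n)/f²`**, the norm of `σ_f = (γ + k)/f`. [cite: Cox2013, §7.A Lemma 7.2] -/
def nOf (t : ℤ) (n : ℕ) (f : ℕ) : ℤ := (shift t n ^ 2 + t * shift t n + n) / (f : ℤ) ^ 2

/-- `f t_f = t + 2k`. [folklore] -/
theorem mul_tOf (h : t ^ 2 < 4 * n) {f : ℕ} (hf : f ∈ ellipticConductors t n) :
    (f : ℤ) * tOf t n f = t + 2 * shift t n :=
  Int.mul_ediv_cancel' (dvd_shift h hf).1

/-- `f² n_f = k² + tk + n`. [folklore] -/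
theorem sq_mul_nOf (h : t ^ 2 < 4 * n) {f : ℕ} (hf : f ∈ ellipticConductors t n) :
    (f : ℤ) ^ 2 * nOf t n f = shift t n ^ 2 + t * shift t n + n :=
  Int.mul_ediv_cancel' (dvd_shift h hf).2

/-- **`f² (t_f² - 4 n_f) = t² - 4n`**: `B_f` has discriminant `(t² - 4n)/f²`. [cite: Cox2013, §7.A (7.3)] -/
theorem sq_mul_disc (h : t ^ 2 < 4 * n) {f : ℕ} (hf : f ∈ ellipticConductors t n) :
    (f : ℤ) ^ 2 * (tOf t n f ^ 2 - 4 * nOf t n f) = t ^ 2 - 4 * n := by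
  have h1 := mul_tOf h hf
  have h2 := sq_mul_nOf h hf
  have : (f : ℤ) ^ 2 * (tOf t n f ^ 2 - 4 * nOf t n f) = ((f : ℤ) * tOf t n f) ^ 2 - 4 * ((f : ℤ) ^ 2 * nOf t n f) := by ring
  rw [this, h1, h2]; ring

/-- `(t² - 4n)/f² = t_f² - 4n_f`. [cite: Cox2013, §7.A (7.3)] -/
theorem disc_div_sq (h : t ^ 2 < 4 * n) {f : ℕ} (hf : f ∈ ellipticConductors t n) :
    (t ^ 2 - 4 * n) / (f : ℤ) ^ 2 = tOf t n f ^ 2 - 4 * nOf t n f := by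
  rw [← sq_mul_disc h hf, Int.mul_ediv_cancel_left _ (pow_ne_zero 2 (by exact_mod_cast (pos_of_mem_ellipticConductors h hf).ne'))]

/-- The discriminant of `B_f` is negative. [folklore] -/
theorem disc_tOf_neg (h : t ^ 2 < 4 * n) {f : ℕ} (hf : f ∈ ellipticConductors t n) :
    tOf t n f ^ 2 - 4 * nOf t n f < 0 := by
  have h1 := sq_mul_disc h hf
  have hf0 : (0 : ℤ) < (f : ℤ) ^ 2 := by
    have := pos_of_mem_ellipticConductors h hf; positivity
  by_contra hge; push Not at hge
  have : 0 ≤ (f : ℤ) ^ 2 * (tOf t n f ^ 2 - 4 * nOf t n f) := mul_nonneg hf0.le hge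
  linarith

/-- **Along a step `f ∣ fq`: `t_f = q t_{fq}`, `n_f = q² n_{fq}`** (`σ_f = q σ_{fq}`). [folklore] -/
theorem tOf_eq_mul (h : t ^ 2 < 4 * n) {f c : ℕ} (hfc : f * c ∈ ellipticConductors t n) :
    tOf t n f = c * tOf t n (f * c) ∧ nOf t n f = (c : ℤ) ^ 2 * nOf t n (f * c) := by
  have hf : f ∈ ellipticConductors t n := dvd_mem_ellipticConductors h hfc (dvd_mul_right f c)
  have hf0 : (f : ℤ) ≠ 0 := by exact_mod_cast (pos_of_mem_ellipticConductors h hf).ne'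
  have h1 := mul_tOf h hf
  have h2 := mul_tOf h hfc
  have h3 := sq_mul_nOf h hf
  have h4 := sq_mul_nOf h hfc
  push_cast at h2 h4
  constructor
  · apply mul_left_cancel₀ hf0
    rw [h1, ← h2]; ring
  · apply mul_left_cancel₀ (pow_ne_zero 2 hf0)
    rw [h3, ← h4]; ring

/-! ### Root counts modulo `q` -/

/-- **`ρ_q(t', n') = #{x mod q : x² - t'x + n' ≡ 0 (mod q)}`.** [cite: Cox2013, §7.D (Legendre symbol and splitting of primes in orders)] -/
def rho (q : ℕ) (t' n' : ℤ) : ℕ :=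
  ((Finset.range q).filter fun x : ℕ => (q : ℤ) ∣ (x : ℤ) ^ 2 - t' * x + n').card

/-- The count with `+ t'` instead of `- t'` is the same (`x ↦ -x`). [folklore] -/
theorem card_filter_add_eq_rho {q : ℕ} (hq : q ≠ 0) (t' n' : ℤ) :
    ((Finset.range q).filter fun k : ℕ => (q : ℤ) ∣ (k : ℤ) ^ 2 + t' * k + n').card = rho q t' n' := by
  unfold rho
  -- the involution `k ↦ (q - k) % q` on `range q`
  have hinv : ∀ k : ℕ, k < q → (q - (q - k) % q) % q = k := by
    intro k hk
    rcases Nat.eq_zero_or_pos k with rfl | hk0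
    · simp [Nat.mod_self]
    · rw [Nat.mod_eq_of_lt (by omega : q - k < q), Nat.sub_sub_self hk.le, Nat.mod_eq_of_lt hk]
  have hcast : ∀ k : ℕ, k < q → (q : ℤ) ∣ (((q - k) % q : ℕ) : ℤ) + k := by
    intro k hk
    rcases Nat.eq_zero_or_pos k with rfl | hk0
    · simp
    · rw [Nat.mod_eq_of_lt (by omega : q - k < q)]; push_cast [hk.le]; simp
  refine Finset.card_bij (fun k _ => (q - k) % q) (fun k hk => ?_) (fun k hk k' hk' hkk' => ?_) (fun x hx => ?_)
  · rw [Finset.mem_filter, Finset.mem_range] at hk ⊢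
    refine ⟨Nat.mod_lt _ (Nat.pos_of_ne_zero hq), ?_⟩
    obtain ⟨c, hc⟩ := hcast k hk.1
    have e : (((q - k) % q : ℕ) : ℤ) = q * c - k := by linear_combination hc
    rw [e]
    have : ((q : ℤ) * c - k) ^ 2 - t' * ((q : ℤ) * c - k) + n' = ((k : ℤ) ^ 2 + t' * k + n') + q * (q * c ^ 2 - 2 * c * k - t' * c) := by ring
    rw [this]
    exact dvd_add hk.2 (dvd_mul_right _ _)
  · have h1 := (Finset.mem_range.mp (Finset.mem_filter.mp hk).1)
    have h2 := (Finset.mem_range.mp (Finset.mem_filter.mp hk').1)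
    rw [← hinv k h1, ← hinv k' h2, hkk']
  · rw [Finset.mem_filter, Finset.mem_range] at hx
    refine ⟨(q - x) % q, ?_, hinv x hx.1⟩
    rw [Finset.mem_filter, Finset.mem_range]
    refine ⟨Nat.mod_lt _ (Nat.pos_of_ne_zero hq), ?_⟩
    obtain ⟨c, hc⟩ := hcast x hx.1
    have e : (((q - x) % q : ℕ) : ℤ) = q * c - x := by linear_combination hc
    rw [e]
    have : ((q : ℤ) * c - x) ^ 2 + t' * ((q : ℤ) * c - x) + n' = ((x : ℤ) ^ 2 - t' * x + n') + q * (q * c ^ 2 - 2 * c * x + t' * c) := by ring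
    rw [this]
    exact dvd_add hx.2 (dvd_mul_right _ _)

/-- Roots modulo `q` read in `ZMod q`. [folklore] -/
theorem dvd_quad_iff_zmod {q : ℕ} (t' n' : ℤ) (x : ℕ) :
    (q : ℤ) ∣ (x : ℤ) ^ 2 - t' * x + n' ↔ ((x : ZMod q)) ^ 2 - (t' : ZMod q) * x + (n' : ZMod q) = 0 := by
  rw [← ZMod.intCast_zmod_eq_zero_iff_dvd]; push_cast; rfl

/-- **`ρ_q = 1` when `q ∣ t'² - 4n'`** (a double root). [cite: Cox2013, §7.D Prop. 7.20 (ramified case)] -/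
theorem rho_eq_one_of_dvd {q : ℕ} (hq : q.Prime) {t' n' : ℤ} (hd : (q : ℤ) ∣ t' ^ 2 - 4 * n') :
    rho q t' n' = 1 := by
  unfold rho
  rw [Finset.card_eq_one]
  rcases hq.eq_two_or_odd' with rfl | hodd
  · -- `q = 2`: `t'` is even and exactly one of `0, 1` is a root
    have ht : (2 : ℤ) ∣ t' := by
      have : (2 : ℤ) ∣ t' ^ 2 := by
        have e : t' ^ 2 = (t' ^ 2 - 4 * n') + 2 * (2 * n') := by ring
        rw [e]; exact dvd_add (by exact_mod_cast hd) (dvd_mul_right _ _)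
      exact Int.prime_two.dvd_of_dvd_pow this
    obtain ⟨s, rfl⟩ := ht
    by_cases hn2 : (2 : ℤ) ∣ n'
    · refine ⟨0, ?_⟩
      ext x
      simp only [Finset.mem_filter, Finset.mem_range, Finset.mem_singleton, Nat.cast_ofNat]
      constructor
      · rintro ⟨hx, hdx⟩
        interval_cases x
        · rfl
        · exfalso; norm_num at hdx; omega
      · rintro rfl; exact ⟨by norm_num, by norm_num; exact hn2⟩
    · refine ⟨1, ?_⟩
      ext x
      simp only [Finset.mem_filter, Finset.mem_range, Finset.mem_singleton, Nat.cast_ofNat]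
      constructor
      · rintro ⟨hx, hdx⟩
        interval_cases x
        · exfalso; norm_num at hdx; exact hn2 hdx
        · rfl
      · rintro rfl; refine ⟨by norm_num, ?_⟩; norm_num; omega
  · -- `q` odd: the unique root is `x ≡ t'/2`
    haveI := Fact.mk hq
    have hq2 : q ≠ 2 := by rintro rfl; exact absurd hodd (by decide)
    have h2u : IsUnit (2 : ZMod q) := by
      have e : ((2 : ℕ) : ZMod q) = 2 := by norm_cast
      rw [← e, ZMod.isUnit_iff_coprime]; exact (Nat.coprime_primes Nat.prime_two hq).mpr (Ne.symm hq2)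
    have h4u : IsUnit (4 : ZMod q) := by
      have := h2u.mul h2u; rw [show (2 : ZMod q) * 2 = 4 by norm_num] at this; exact this
    set x₀ : ZMod q := ((h2u.unit⁻¹ : (ZMod q)ˣ) : ZMod q) * (t' : ZMod q) with hx₀
    have hd' : ((t' : ZMod q)) ^ 2 - 4 * (n' : ZMod q) = 0 := by
      have := (ZMod.intCast_zmod_eq_zero_iff_dvd _ _).mpr hd; push_cast at this; exact this
    have hroot : ∀ x : ZMod q, x ^ 2 - (t' : ZMod q) * x + n' = 0 ↔ x = x₀ := by
      intro x
      have e : (4 : ZMod q) * (x ^ 2 - t' * x + n') = (2 * x - t') ^ 2 := by linear_combination -hd'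
      constructor
      · intro hx
        have h0 : (2 * x - t') ^ 2 = 0 := by rw [← e, hx, mul_zero]
        have h2x : 2 * x = t' := sub_eq_zero.mp (pow_eq_zero_iff two_ne_zero |>.mp h0)
        calc x = ((h2u.unit⁻¹ : (ZMod q)ˣ) : ZMod q) * (2 * x) := by
              rw [← mul_assoc, IsUnit.val_inv_mul, one_mul]
          _ = x₀ := by rw [h2x]
      · intro hx
        have h2x : 2 * x = t' := by rw [hx, hx₀, ← mul_assoc, IsUnit.mul_val_inv, one_mul]
        have h0 : (4 : ZMod q) * (x ^ 2 - t' * x + n') = 0 := by rw [e, h2x, sub_self, zero_pow two_ne_zero]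
        exact h4u.mul_right_eq_zero.mp h0
    refine ⟨x₀.val, ?_⟩
    ext x
    simp only [Finset.mem_filter, Finset.mem_range, Finset.mem_singleton]
    constructor
    · rintro ⟨hx, hdx⟩
      have := (hroot _).mp ((dvd_quad_iff_zmod t' n' x).mp hdx)
      rw [← this, ZMod.val_natCast, Nat.mod_eq_of_lt hx]
    · rintro rfl
      exact ⟨ZMod.val_lt _, (dvd_quad_iff_zmod t' n' _).mpr ((hroot _).mpr (ZMod.natCast_zmod_val _))⟩

/-- **`ρ_q ≤ 2`** (a quadratic over the field `𝔽_q`). [folklore] -/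
theorem rho_le_two {q : ℕ} (hq : q.Prime) (t' n' : ℤ) : rho q t' n' ≤ 2 := by
  classical
  haveI := Fact.mk hq
  unfold rho
  open Polynomial in
  set P : (ZMod q)[X] := X ^ 2 - C (t' : ZMod q) * X + C (n' : ZMod q) with hP
  have hPdeg : P.natDegree = 2 := by
    rw [hP]; compute_degree!
  have hP0 : P ≠ 0 := by rintro h; rw [h, Polynomial.natDegree_zero] at hPdeg; exact absurd hPdeg (by norm_num)
  have hle : ((Finset.range q).filter fun x : ℕ => (q : ℤ) ∣ (x : ℤ) ^ 2 - t' * x + n').card ≤ P.roots.toFinset.card := by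
    refine Finset.card_le_card_of_injOn (fun x : ℕ => (x : ZMod q)) (fun x hx => ?_) (fun x hx y hy hxy => ?_)
    · rw [Finset.mem_coe, Finset.mem_filter] at hx
      rw [Finset.mem_coe, Multiset.mem_toFinset, Polynomial.mem_roots hP0, Polynomial.IsRoot, hP]
      simp only [Polynomial.eval_add, Polynomial.eval_sub, Polynomial.eval_pow, Polynomial.eval_X,
        Polynomial.eval_mul, Polynomial.eval_C]
      exact (dvd_quad_iff_zmod t' n' x).mp hx.2
    · have h₁ := Finset.mem_range.mp (Finset.mem_filter.mp (Finset.mem_coe.mp hx)).1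
      have h₂ := Finset.mem_range.mp (Finset.mem_filter.mp (Finset.mem_coe.mp hy)).1
      have := congrArg ZMod.val hxy
      rwa [ZMod.val_cast_of_lt h₁, ZMod.val_cast_of_lt h₂] at this
  refine hle.trans ((Multiset.toFinset_card_le _).trans ?_)
  rw [← hPdeg]; exact Polynomial.card_roots' P

/-- `ρ_q` read in `ZMod q`. [folklore] -/
theorem rho_eq_card_zmod {q : ℕ} [NeZero q] (t' n' : ℤ) :
    rho q t' n' = (Finset.univ.filter fun x : ZMod q => x ^ 2 - (t' : ZMod q) * x + (n' : ZMod q) = 0).card := by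
  unfold rho
  refine Finset.card_bij (fun x _ => (x : ZMod q)) (fun x hx => ?_) (fun x hx y hy hxy => ?_) (fun y hy => ?_)
  · rw [Finset.mem_filter, Finset.mem_range] at hx
    rw [Finset.mem_filter]
    exact ⟨Finset.mem_univ _, (dvd_quad_iff_zmod t' n' x).mp hx.2⟩
  · have h₁ := Finset.mem_range.mp (Finset.mem_filter.mp hx).1
    have h₂ := Finset.mem_range.mp (Finset.mem_filter.mp hy).1
    have := congrArg ZMod.val hxy
    rwa [ZMod.val_cast_of_lt h₁, ZMod.val_cast_of_lt h₂] at this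
  · refine ⟨y.val, ?_, ZMod.natCast_zmod_val y⟩
    rw [Finset.mem_filter, Finset.mem_range]
    refine ⟨ZMod.val_lt y, (dvd_quad_iff_zmod t' n' _).mpr ?_⟩
    rw [ZMod.natCast_zmod_val]; exact (Finset.mem_filter.mp hy).2

/-- **Invariance of `ρ_q` under `σ ↦ σ + k`**: `ρ_q(t' + 2k, k² + t'k + n') = ρ_q(t', n')`. [folklore] -/
theorem rho_shift {q : ℕ} [NeZero q] (t' n' k : ℤ) :
    rho q (t' + 2 * k) (k ^ 2 + t' * k + n') = rho q t' n' := by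
  rw [rho_eq_card_zmod, rho_eq_card_zmod]
  refine Finset.card_bij (fun x _ => x - (k : ZMod q)) (fun x hx => ?_) (fun x _ y _ hxy => ?_) (fun y hy => ?_)
  · rw [Finset.mem_filter] at hx ⊢
    refine ⟨Finset.mem_univ _, ?_⟩
    have h := hx.2; push_cast at h
    linear_combination h
  · exact sub_left_injective hxy
  · refine ⟨y + (k : ZMod q), ?_, by simp⟩
    rw [Finset.mem_filter] at hy ⊢
    refine ⟨Finset.mem_univ _, ?_⟩
    push_cast
    linear_combination hy.2

/-- **Invariance of `ρ_q` under `σ ↦ c σ` for `q ∤ c`**: `ρ_q(c t', c² n') = ρ_q(t', n')`. [folklore] -/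
theorem rho_scale {q : ℕ} [NeZero q] (t' n' : ℤ) {c : ℤ} (hc : IsUnit (c : ZMod q)) :
    rho q (c * t') (c ^ 2 * n') = rho q t' n' := by
  rw [rho_eq_card_zmod, rho_eq_card_zmod]
  symm
  refine Finset.card_bij (fun y _ => (c : ZMod q) * y) (fun y hy => ?_) (fun x _ y _ hxy => ?_) (fun x hx => ?_)
  · rw [Finset.mem_filter] at hy ⊢
    refine ⟨Finset.mem_univ _, ?_⟩
    have h := hy.2
    push_cast
    linear_combination (c : ZMod q) ^ 2 * h
  · exact hc.mul_left_cancel hxy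
  · refine ⟨((hc.unit⁻¹ : (ZMod q)ˣ) : ZMod q) * x, ?_, by rw [← mul_assoc, IsUnit.mul_val_inv, one_mul]⟩
    rw [Finset.mem_filter] at hx ⊢
    refine ⟨Finset.mem_univ _, ?_⟩
    have h := hx.2
    have e : (c : ZMod q) * ((hc.unit⁻¹ : (ZMod q)ˣ) : ZMod q) = 1 := IsUnit.mul_val_inv hc
    apply (hc.pow 2).mul_left_cancel
    rw [mul_zero]
    simp only [Int.cast_mul, Int.cast_pow] at h ⊢
    linear_combination h +
      (x ^ 2 * ((c : ZMod q) * ((hc.unit⁻¹ : (ZMod q)ˣ) : ZMod q) + 1) - (c : ZMod q) * t' * x) * e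

/-! ### Root counts of the orders `B_f` -/

/-- **`ρ_q(t_1, n_1) = ρ_q(t, n)`** (`σ_1 = γ + k`). [folklore] -/
theorem rho_tOf_one (h : t ^ 2 < 4 * n) {q : ℕ} [NeZero q] : rho q (tOf t n 1) (nOf t n 1) = rho q t n := by
  have h1 := mul_tOf h (one_mem_ellipticConductors h)
  have h2 := sq_mul_nOf h (one_mem_ellipticConductors h)
  simp only [Nat.cast_one, one_mul, one_pow] at h1 h2
  rw [h1, h2, show shift t n ^ 2 + t * shift t n + (n : ℤ) = shift t n ^ 2 + t * shift t n + n by rfl, rho_shift]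

/-- **`ρ_q(t_g, n_g) = ρ_q(t_f, n_f)` for `g ∣ f` with `q ∤ f/g`** (`σ_g = (f/g) σ_f`). [folklore] -/
theorem rho_tOf_eq_of_dvd (h : t ^ 2 < 4 * n) {q : ℕ} (hq : q.Prime) {f g : ℕ} (hf : f ∈ ellipticConductors t n)
    (hgf : g ∣ f) (hq' : ¬ q ∣ f / g) : rho q (tOf t n g) (nOf t n g) = rho q (tOf t n f) (nOf t n f) := by
  haveI := Fact.mk hq
  obtain ⟨c, rfl⟩ := hgf
  have hg0 : 0 < g := Nat.pos_of_ne_zero fun h0 => by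
    subst h0; simp at hf; exact absurd (pos_of_mem_ellipticConductors h hf) (lt_irrefl 0)
  rw [Nat.mul_div_cancel_left _ hg0] at hq'
  obtain ⟨h1, h2⟩ := tOf_eq_mul h hf
  rw [h1, h2]
  refine rho_scale _ _ ?_
  rw [show ((c : ℤ) : ZMod q) = ((c : ℕ) : ZMod q) by simp, ZMod.isUnit_iff_coprime]
  exact (Nat.coprime_comm.mp ((Nat.Prime.coprime_iff_not_dvd hq).mpr hq'))

/-- **`ρ_q(t_f, n_f) = ρ_q(t, n)` for `q ∤ f`.** [folklore] -/
theorem rho_tOf_eq (h : t ^ 2 < 4 * n) {q : ℕ} (hq : q.Prime) {f : ℕ} (hf : f ∈ ellipticConductors t n)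
    (hqf : ¬ q ∣ f) : rho q (tOf t n f) (nOf t n f) = rho q t n := by
  haveI := Fact.mk hq
  rw [← rho_tOf_eq_of_dvd h hq hf (one_dvd f) (by rwa [Nat.div_one]), rho_tOf_one h]

/-- **`ρ_q(t_f, n_f) = 1` when `fq` is a conductor** (`q² ∣ disc B_f`). [cite: Cox2013, §7.D Prop. 7.20] -/
theorem rho_tOf_eq_one (h : t ^ 2 < 4 * n) {q : ℕ} (hq : q.Prime) {f : ℕ}
    (hfq : f * q ∈ ellipticConductors t n) : rho q (tOf t n f) (nOf t n f) = 1 := by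
  obtain ⟨h1, h2⟩ := tOf_eq_mul h hfq
  refine rho_eq_one_of_dvd hq ⟨(q : ℤ) * (tOf t n (f * q) ^ 2 - 4 * nOf t n (f * q)), ?_⟩
  rw [h1, h2]; ring

/-- **`B_f` is non-maximal at `q` iff `fq` is a conductor.** [cite: Cox2013, §7.A (orders and conductors)] -/
theorem nonmax_iff (h : t ^ 2 < 4 * n) {q : ℕ} (hq : q.Prime) {f : ℕ} (hf : f ∈ ellipticConductors t n) :
    (∃ k : ℤ, (q : ℤ) ∣ tOf t n f + 2 * k ∧ (q : ℤ) ^ 2 ∣ k ^ 2 + tOf t n f * k + nOf t n f) ↔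
      f * q ∈ ellipticConductors t n := by
  have hf0 := pos_of_mem_ellipticConductors h hf
  constructor
  · rintro ⟨k, ⟨a, ha⟩, ⟨b, hb⟩⟩
    rw [mem_ellipticConductors_iff h]
    have hdisc : tOf t n f ^ 2 - 4 * nOf t n f = (q : ℤ) ^ 2 * (a ^ 2 - 4 * b) := by
      have e : tOf t n f ^ 2 - 4 * nOf t n f = (tOf t n f + 2 * k) ^ 2 - 4 * (k ^ 2 + tOf t n f * k + nOf t n f) := by ring
      rw [e, ha, hb]; ring
    have hΔ : t ^ 2 - 4 * n = (((f * q : ℕ) : ℤ)) ^ 2 * (a ^ 2 - 4 * b) := by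
      rw [← sq_mul_disc h hf, hdisc]; push_cast; ring
    have hfq0 : ((f * q : ℕ) : ℤ) ≠ 0 := by exact_mod_cast (Nat.mul_pos hf0 hq.pos).ne'
    refine ⟨Nat.mul_pos hf0 hq.pos, ⟨_, hΔ⟩, ?_⟩
    rw [hΔ, Int.mul_ediv_cancel_left _ (pow_ne_zero 2 hfq0)]
    have e : (a ^ 2 - 4 * b) % 4 = a ^ 2 % 4 := by
      rw [Int.sub_emod, Int.mul_emod_right, sub_zero, Int.emod_emod_of_dvd _ (dvd_refl _)]
    rw [e]; simpa using sq_mul_emod_four a 1 (Or.inr (by norm_num))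
  · intro hfq
    obtain ⟨h1, h2⟩ := tOf_eq_mul h hfq
    refine ⟨0, ?_, ?_⟩
    · rw [mul_zero, add_zero, h1]; exact dvd_mul_right _ _
    · simp only [zero_pow two_ne_zero, mul_zero, zero_add, add_zero, h2]; exact dvd_mul_right _ _

/-- **`#{x mod q : q² ∣ x² - tx + n} = 1` for `q ∣ f`, `f` a conductor** (the local density at
`q ∣ f` is `(q + 1) · 1`). [cite: SchoofVandervlugt1991, Thm. 2.2 (μ(t, f, n) for N_f = N)] -/
theorem card_sq_dvd_eq_one (h : t ^ 2 < 4 * n) {q : ℕ} (hq : q.Prime) {f : ℕ} (hf : f ∈ ellipticConductors t n)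
    (hqf : q ∣ f) :
    ((Finset.range q).filter fun x : ℕ => ((q * q : ℕ) : ℤ) ∣ (x : ℤ) ^ 2 - t * x + n).card = 1 := by
  have hqEC : q ∈ ellipticConductors t n := dvd_mem_ellipticConductors h hf hqf
  obtain ⟨⟨a, ha⟩, ⟨b, hb⟩⟩ := dvd_shift h hqEC
  set k := shift t n
  have hq0 : (0 : ℤ) < q := by exact_mod_cast hq.pos
  -- the root `x₀ ≡ -k`
  set x₀ : ℕ := ((-k) % (q : ℤ)).toNat with hx₀
  have hx₀Z : (x₀ : ℤ) = (-k) % q := Int.toNat_of_nonneg (Int.emod_nonneg _ hq0.ne')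
  have hx₀lt : x₀ < q := by have := Int.emod_lt_of_pos (-k) hq0; omega
  obtain ⟨c, hc⟩ : (q : ℤ) ∣ (x₀ : ℤ) + k := by
    rw [hx₀Z, ← Int.emod_emod_of_dvd (-k) (dvd_refl (q : ℤ))]
    have := Int.emod_emod_of_dvd (-k) (dvd_refl (q : ℤ))
    rw [Int.dvd_iff_emod_eq_zero, Int.add_emod, this, Int.emod_emod_of_dvd _ (dvd_refl _), ← Int.add_emod,
      neg_add_cancel, Int.zero_emod]
  have hqq : ((q * q : ℕ) : ℤ) = (q : ℤ) ^ 2 := by push_cast; ring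
  have key : ∀ x : ℕ, ((q * q : ℕ) : ℤ) ∣ (x : ℤ) ^ 2 - t * x + n ↔ (q : ℤ) ∣ (x : ℤ) + k := by
    intro x
    rw [hqq]
    have e : (x : ℤ) ^ 2 - t * x + n = ((x : ℤ) + k) * (((x : ℤ) + k) - (t + 2 * k)) + (k ^ 2 + t * k + n) := by ring
    constructor
    · intro hx
      -- `q² ∣ (x + k)(x + k - (t+2k))` and `q ∣ t + 2k` ⇒ `q ∣ (x+k)²` ⇒ `q ∣ x + k`
      rw [e, hb] at hx
      have h1 : ((q : ℤ)) ^ 2 ∣ ((x : ℤ) + k) * (((x : ℤ) + k) - (t + 2 * k)) := by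
        have := dvd_sub hx (dvd_mul_right (((q : ℤ)) ^ 2) b)
        rwa [add_sub_cancel_right] at this
      have h2 : (q : ℤ) ∣ ((x : ℤ) + k) ^ 2 := by
        have h3 : (q : ℤ) ∣ ((x : ℤ) + k) * (((x : ℤ) + k) - (t + 2 * k)) := (dvd_pow_self _ two_ne_zero).trans h1
        have e2 : ((x : ℤ) + k) ^ 2 = ((x : ℤ) + k) * (((x : ℤ) + k) - (t + 2 * k)) + ((x : ℤ) + k) * (t + 2 * k) := by ring
        rw [e2]
        exact dvd_add h3 (by rw [ha]; exact Dvd.dvd.mul_left (dvd_mul_right _ _) _)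
      exact (Int.prime_iff_natAbs_prime.mpr (by simpa using hq)).dvd_of_dvd_pow h2
    · rintro ⟨d, hd⟩
      rw [e, hd, ha, hb]
      exact dvd_add ⟨d * (d - a), by ring⟩ (dvd_mul_right _ _)
  rw [Finset.card_eq_one]
  refine ⟨x₀, ?_⟩
  ext x
  simp only [Finset.mem_filter, Finset.mem_range, Finset.mem_singleton]
  constructor
  · rintro ⟨hx, hdx⟩
    rw [key] at hdx
    -- `x ≡ x₀ (mod q)`, both `< q`
    have h1 : (q : ℤ) ∣ (x : ℤ) - x₀ := by
      have := dvd_sub hdx ⟨c, hc⟩; rwa [add_sub_add_right_eq_sub] at this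
    have h2 : ((x : ℤ) - x₀).natAbs < q := by
      have hx' : (x : ℤ) < q := by exact_mod_cast hx
      have hx₀' : (x₀ : ℤ) < q := by exact_mod_cast hx₀lt
      omega
    have h3 := Int.eq_zero_of_dvd_of_natAbs_lt_natAbs h1 (by simpa using h2)
    exact_mod_cast (sub_eq_zero.mp h3)
  · rintro rfl
    exact ⟨hx₀lt, (key x₀).mpr ⟨c, hc⟩⟩

end Arith

/-! ### The orders `B_f = ℤ[σ_f]` through `γ` -/

section Orders

variable {D : Type u} [Ring D] [Algebra ℚ D] [IsQuaternionAlgebra ℚ D] {γ : D} {t : ℤ} {n : ℕ}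

/-- **`σ_f = (γ + k)/f = k/f + γ/f`.** [cite: Cox2013, §7.A Lemma 7.2] -/
def σf (γ : D) (t : ℤ) (n : ℕ) (f : ℕ) : D := algebraMap ℚ D ((shift t n : ℚ) / f) + ((f : ℚ))⁻¹ • γ

/-- **`B_f = ℤ[σ_f] = [1, σ_f]`**, the order of conductor index `f` over `ℤ[γ]`. [cite: Cox2013, §7.A Lemma 7.2] -/
def ordOf (γ : D) (t : ℤ) (n : ℕ) (f : ℕ) : Submodule ℤ D := Submodule.span ℤ {1, σf γ t n f}

omit [IsQuaternionAlgebra ℚ D] in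
/-- Membership in `B_f`. [folklore] -/
theorem mem_ordOf_iff {f : ℕ} {b : D} : b ∈ ordOf γ t n f ↔ ∃ u v : ℤ, b = algebraMap ℚ D u + v • σf γ t n f := by
  unfold ordOf
  rw [Submodule.mem_span_pair]
  constructor
  · rintro ⟨u, v, rfl⟩
    exact ⟨u, v, by rw [Algebra.algebraMap_eq_smul_one, Int.cast_smul_eq_zsmul]⟩
  · rintro ⟨u, v, rfl⟩
    exact ⟨u, v, by rw [Algebra.algebraMap_eq_smul_one, Int.cast_smul_eq_zsmul]⟩

omit [IsQuaternionAlgebra ℚ D] in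
/-- `σ_f = f⁻¹ (γ + k)`. [folklore] -/
theorem σf_eq (f : ℕ) : σf γ t n f = ((f : ℚ))⁻¹ • (γ + algebraMap ℚ D (shift t n : ℚ)) := by
  unfold σf
  rw [div_eq_inv_mul, map_mul, ← Algebra.smul_def, smul_add, add_comm]

omit [IsQuaternionAlgebra ℚ D] in
/-- **`σ_g = (f/g) σ_f` for `g ∣ f`.** [folklore] -/
theorem σf_eq_smul_of_dvd {f g : ℕ} (hgf : g ∣ f) (hf : f ≠ 0) : σf γ t n g = ((f / g : ℕ) : ℚ) • σf γ t n f := by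
  obtain ⟨c, rfl⟩ := hgf
  have hg : g ≠ 0 := fun h0 => hf (by rw [h0, zero_mul])
  have hc : c ≠ 0 := fun h0 => hf (by rw [h0, mul_zero])
  have hg0 : 0 < g := Nat.pos_of_ne_zero hg
  rw [Nat.mul_div_cancel_left _ hg0, σf_eq, σf_eq, smul_smul]
  congr 1
  have hgQ : (g : ℚ) ≠ 0 := by exact_mod_cast hg
  have hcQ : (c : ℚ) ≠ 0 := by exact_mod_cast hc
  push_cast
  field_simp

/-- **Hypotheses on `γ`**: `D` is a division quaternion algebra, `trd γ = t`, `nrd γ = n`,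
`t² < 4n` (so `ℚ(γ)` is an imaginary quadratic field). [cite: VignerasLNM800, Ch. III §5 (C)] -/
structure GammaHyp (γ : D) (t : ℤ) (n : ℕ) : Prop where
  hdiv : ∀ x : D, x ≠ 0 → IsUnit x
  htr : reducedTrace ℚ D γ = t
  hnr : reducedNorm ℚ D γ = n
  hlt : t ^ 2 < 4 * n

namespace GammaHyp

variable (H : GammaHyp γ t n)
include H

omit [IsQuaternionAlgebra ℚ D] in
/-- `trd(γ)² < 4 nrd(γ)`. [folklore] -/
theorem himag : reducedTrace ℚ D γ ^ 2 < 4 * reducedNorm ℚ D γ := by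
  rw [H.htr, H.hnr]; exact_mod_cast H.hlt

/-- `γ ∉ ℚ`. [folklore] -/
theorem hγ : γ ∉ (⊥ : Subalgebra ℚ D) := by
  intro h
  rw [Algebra.mem_bot] at h
  obtain ⟨c, hc⟩ := h
  have ht := H.htr
  have hn := H.hnr
  rw [← hc, reducedTrace_algebraMap_rat] at ht
  rw [← hc, reducedNorm_algebraMap] at hn
  have e : ((t : ℚ)) ^ 2 = 4 * (n : ℚ) := by rw [← ht, ← hn]; ring
  have : t ^ 2 = 4 * (n : ℤ) := by exact_mod_cast e
  have := H.hlt
  omega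

/-- `γ² = tγ - n`. [folklore] -/
theorem sq : γ * γ = (t : ℚ) • γ - algebraMap ℚ D (n : ℚ) := by
  rw [mul_self_eq_reducedTrace_mul_sub_reducedNorm ℚ D γ, H.htr, H.hnr, ← Algebra.smul_def]

/-- **`σ_f² = t_f σ_f - n_f`** for a conductor `f`. [cite: Cox2013, §7.A Lemma 7.2] -/
theorem σf_sq {f : ℕ} (hf : f ∈ ellipticConductors t n) :
    σf γ t n f * σf γ t n f = (tOf t n f : ℚ) • σf γ t n f - algebraMap ℚ D (nOf t n f : ℚ) := by
  have hf0 : (f : ℚ) ≠ 0 := by exact_mod_cast (pos_of_mem_ellipticConductors H.hlt hf).ne'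
  have htQ : (tOf t n f : ℚ) = ((t : ℚ) + 2 * shift t n) / f := by
    rw [eq_div_iff hf0, mul_comm]; exact_mod_cast mul_tOf H.hlt hf
  have hnQ : (nOf t n f : ℚ) = ((shift t n : ℚ) ^ 2 + t * shift t n + n) / (f : ℚ) ^ 2 := by
    rw [eq_div_iff (pow_ne_zero 2 hf0), mul_comm]; exact_mod_cast sq_mul_nOf H.hlt hf
  rw [σf_eq, htQ, hnQ, Algebra.algebraMap_eq_smul_one, Algebra.algebraMap_eq_smul_one]
  have hsq : γ * γ = (t : ℚ) • γ - (n : ℚ) • (1 : D) := by rw [H.sq, Algebra.algebraMap_eq_smul_one]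
  simp only [smul_add, mul_add, add_mul, smul_mul_assoc, mul_smul_comm, mul_one, one_mul, smul_smul, hsq,
    smul_sub]
  module

omit H in
omit [IsQuaternionAlgebra ℚ D] in
/-- `σ_f ∈ ℚ(γ)`. [folklore] -/
theorem σf_mem_adjoin (f : ℕ) : σf γ t n f ∈ Algebra.adjoin ℚ {γ} :=
  Subalgebra.add_mem _ (Subalgebra.algebraMap_mem _ _) (Subalgebra.smul_mem _ (Algebra.self_mem_adjoin_singleton ℚ γ) _)

omit H in
omit [IsQuaternionAlgebra ℚ D] in
/-- **`γ = f σ_f - k ∈ B_f`.** [folklore] -/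
theorem γ_eq {f : ℕ} (hf : f ≠ 0) : γ = (f : ℤ) • σf γ t n f + (((-shift t n : ℤ) : D)) := by
  have hf0 : (f : ℚ) ≠ 0 := by exact_mod_cast hf
  rw [σf_eq, ← Int.cast_smul_eq_zsmul ℚ, smul_smul, Int.cast_natCast, mul_inv_cancel₀ hf0, one_smul,
    Int.cast_neg, ← map_intCast (algebraMap ℚ D)]
  abel

/-- `σ_f ∉ ℚ`. [folklore] -/
theorem σf_not_mem_bot {f : ℕ} (hf : f ≠ 0) : σf γ t n f ∉ (⊥ : Subalgebra ℚ D) := by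
  intro h
  apply H.hγ
  rw [γ_eq (γ := γ) (t := t) (n := n) hf]
  exact Subalgebra.add_mem _ (Subalgebra.zsmul_mem _ h _) (Subalgebra.intCast_mem _ _)

/-- **`B_f` is an order of `ℚ(γ)` through `γ`.** [cite: Cox2013, §7.A Lemma 7.2] -/
theorem isQuadOrder_ordOf {f : ℕ} (hf : f ∈ ellipticConductors t n) : IsQuadOrder γ (ordOf γ t n f) := by
  have hf0 : f ≠ 0 := (pos_of_mem_ellipticConductors H.hlt hf).ne'
  have hK := isKLattice_span_pair H.hdiv H.hγ (σf_mem_adjoin f) (H.σf_not_mem_bot hf0)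
  refine ⟨one_mem_span_pair _, mul_mem_span_pair_of_sq_mem ?_, ?_, hK.le_adjoin, hK.fg, hK.full⟩
  · rw [H.σf_sq hf, Algebra.algebraMap_eq_smul_one, Int.cast_smul_eq_zsmul, Int.cast_smul_eq_zsmul, sub_eq_add_neg,
      ← neg_smul, add_comm]
    exact zsmul_add_zsmul_mem_span_pair (1 : D) (σf γ t n f) _ _
  · unfold ordOf
    have e : (Int.cast (-shift t n) : D) = (-shift t n : ℤ) • (1 : D) := (zsmul_one (-shift t n)).symm
    have hmem : (f : ℤ) • σf γ t n f + (Int.cast (-shift t n) : D) ∈ Submodule.span ℤ ({1, σf γ t n f} : Set D) := by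
      rw [e, add_comm]
      exact zsmul_add_zsmul_mem_span_pair (1 : D) (σf γ t n f) _ _
    rwa [← γ_eq (γ := γ) (t := t) (n := n) hf0] at hmem

/-- **`B_f` in the setting of `PicHyp`** (so `classNumber γ B_f = h(t_f² - 4n_f)` and `#B_fˣ = w`). [cite: Cox2013, §7.A Lemma 7.2, Thm. 7.7] -/
theorem picHyp_ordOf {f : ℕ} (hf : f ∈ ellipticConductors t n) :
    PicHyp γ (ordOf γ t n f) (σf γ t n f) ((shift t n : ℚ) / f) f (tOf t n f) (nOf t n f) where
  hdiv := H.hdiv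
  hγ := H.hγ
  himag := H.himag
  hB := H.isQuadOrder_ordOf hf
  hm := (pos_of_mem_ellipticConductors H.hlt hf).ne'
  hσ := rfl
  hBσ := fun _ => mem_ordOf_iff
  hsq := H.σf_sq hf

omit H in
omit [IsQuaternionAlgebra ℚ D] in
/-- **`B_g ⊆ B_f` for `g ∣ f`.** [cite: Cox2013, §7.A (orders and conductors)] -/
theorem ordOf_mono {f g : ℕ} (hgf : g ∣ f) (hf : f ≠ 0) : ordOf γ t n g ≤ ordOf γ t n f := by
  unfold ordOf
  rw [Submodule.span_le]
  intro x hx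
  rcases hx with rfl | hx
  · exact one_mem_span_pair _
  · rw [Set.mem_singleton_iff] at hx
    rw [hx, SetLike.mem_coe, σf_eq_smul_of_dvd hgf hf, ← Int.cast_natCast, Int.cast_smul_eq_zsmul]
    exact Submodule.smul_mem _ _ (right_mem_span_pair _)

omit H in
omit [IsQuaternionAlgebra ℚ D] in
/-- `c B_f ⊆ B_g` for `f = g c`. [folklore] -/
theorem smul_mem_ordOf_of_mem {f g : ℕ} (hgf : g ∣ f) (hf : f ≠ 0) {x : D} (hx : x ∈ ordOf γ t n f) :
    ((f / g : ℕ) : ℤ) • x ∈ ordOf γ t n g := by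
  obtain ⟨u, v, rfl⟩ := mem_ordOf_iff.mp hx
  rw [mem_ordOf_iff]
  refine ⟨(f / g : ℕ) * u, v, ?_⟩
  rw [σf_eq_smul_of_dvd hgf hf, smul_add, smul_comm v, ← Int.cast_smul_eq_zsmul ℚ, ← Int.cast_smul_eq_zsmul ℚ ((f / g : ℕ) : ℤ),
    Algebra.smul_def, ← map_mul]
  push_cast
  rfl

omit H in
omit [IsQuaternionAlgebra ℚ D] in
/-- **`(B_g)_(ℓ) = (B_f)_(ℓ)` at primes `ℓ ∤ f/g`.** [cite: Cox2013, §7.C Prop. 7.20 (localisation)] -/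
theorem localAt_ordOf_eq {f g : ℕ} (hgf : g ∣ f) (hf : f ≠ 0) {ℓ : ℕ} (hℓ : ℓ.Prime) (hℓc : ¬ ℓ ∣ f / g) :
    localAt ℓ (ordOf γ t n g) = localAt ℓ (ordOf γ t n f) := by
  refine le_antisymm (localAt_mono ℓ (ordOf_mono (γ := γ) (t := t) (n := n) hgf hf)) fun x hx => ?_
  obtain ⟨m, hm0, hm, hmx⟩ := mem_localAt_iff.mp hx
  have hc0 : f / g ≠ 0 := fun h0 => hℓc (h0 ▸ dvd_zero ℓ)
  refine mem_localAt_of_smul_mem (m := f / g * m) (mul_ne_zero hc0 hm0)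
    (Nat.Coprime.mul_left ((Nat.Prime.coprime_iff_not_dvd hℓ).mpr hℓc).symm hm) ?_
  rw [Nat.cast_mul, mul_smul]
  exact smul_mem_ordOf_of_mem hgf hf hmx

/-- **The step `B_f ⊂ B_{fq}`** in the setting of `StepHyp` (`B_f = [1, q σ_{fq}]`). [cite: Cox2013, Thm. 7.24 (proof); VignerasLNM800, Ch. III §5 Cor. 5.12] -/
theorem stepHyp_ordOf {f q : ℕ} [hq : Fact q.Prime] (hfq : f * q ∈ ellipticConductors t n) :
    StepHyp q γ (ordOf γ t n f) (ordOf γ t n (f * q)) (σf γ t n (f * q)) ((shift t n : ℚ) / (f * q : ℕ)) (f * q)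
      (tOf t n (f * q)) (nOf t n (f * q)) := by
  have hf : f ∈ ellipticConductors t n := dvd_mem_ellipticConductors H.hlt hfq (dvd_mul_right f q)
  have hf0 : f ≠ 0 := (pos_of_mem_ellipticConductors H.hlt hf).ne'
  have hσ : σf γ t n f = (q : ℚ) • σf γ t n (f * q) := by
    rw [σf_eq_smul_of_dvd (dvd_mul_right f q) (pos_of_mem_ellipticConductors H.hlt hfq).ne',
      Nat.mul_div_cancel_left _ (Nat.pos_of_ne_zero hf0)]
  exact
  { hdiv := H.hdiv
    hγ := H.hγ
    hB := H.isQuadOrder_ordOf hf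
    hB' := H.isQuadOrder_ordOf hfq
    hm := (pos_of_mem_ellipticConductors H.hlt hfq).ne'
    hσ := by rw [σf]
    hBσ' := fun _ => mem_ordOf_iff
    hBσ := fun b => by rw [← hσ]; exact mem_ordOf_iff
    hsq := H.σf_sq hfq }

/-- **Every order of `ℚ(γ)` through `γ` is a `B_f`.** [cite: Cox2013, §7.A Lemma 7.2 and (7.2)–(7.3)] -/
theorem exists_eq_ordOf {B : Submodule ℤ D} (hB : IsQuadOrder γ B) :
    ∃ f ∈ ellipticConductors t n, B = ordOf γ t n f := by
  obtain ⟨r₀, m, hm, hσB, hBσ⟩ := hB.exists_monogenic H.hdiv H.hγ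
  set σ₀ := algebraMap ℚ D r₀ + (m : ℚ)⁻¹ • γ with hσ₀
  -- `σ₀² = v₀ σ₀ + u₀`
  obtain ⟨u₀, v₀, hsq0⟩ := (hBσ _).mp (hB.mul_mem _ hσB _ hσB)
  have hsq : σ₀ * σ₀ = (v₀ : ℚ) • σ₀ - algebraMap ℚ D ((-u₀ : ℤ) : ℚ) := by
    rw [hsq0, Int.cast_smul_eq_zsmul, Int.cast_neg, map_neg, sub_neg_eq_add, add_comm]
  obtain ⟨htr0, hnr0⟩ := trd_nrd_of_sq H.hγ hm hσ₀ hsq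
  -- the discriminant: `m² (v₀² + 4u₀) = t² - 4n`
  have hdisc := disc_ratCoords (D := D) (γ := γ) r₀ (m : ℚ)⁻¹
  rw [← hσ₀, htr0, hnr0, H.htr, H.hnr] at hdisc
  have hmQ : (m : ℚ) ≠ 0 := by exact_mod_cast hm
  have hdiscZ : (m : ℤ) ^ 2 * (v₀ ^ 2 + 4 * u₀) = t ^ 2 - 4 * n := by
    have e : ((m : ℚ)) ^ 2 * (((v₀ : ℚ)) ^ 2 - 4 * ((-u₀ : ℤ) : ℚ)) = (t : ℚ) ^ 2 - 4 * (n : ℚ) := by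
      rw [hdisc]; field_simp
    push_cast at e
    exact_mod_cast (by linear_combination e : ((m : ℚ)) ^ 2 * ((v₀ : ℚ) ^ 2 + 4 * u₀) = (t : ℚ) ^ 2 - 4 * n)
  -- `m` is a conductor
  have hmEC : m ∈ ellipticConductors t n := by
    rw [mem_ellipticConductors_iff H.hlt]
    refine ⟨Nat.pos_of_ne_zero hm, ⟨_, hdiscZ.symm⟩, ?_⟩
    rw [← hdiscZ, Int.mul_ediv_cancel_left _ (pow_ne_zero 2 (by exact_mod_cast hm))]
    have e : (v₀ ^ 2 + 4 * u₀) % 4 = v₀ ^ 2 % 4 := by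
      rw [Int.add_emod, Int.mul_emod_right, add_zero, Int.emod_emod_of_dvd _ (dvd_refl _)]
    rw [e]; simpa using sq_mul_emod_four v₀ 1 (Or.inr (by norm_num))
  refine ⟨m, hmEC, ?_⟩
  -- `σ₀ - σ_m = r₀ - k/m` is an integer `j`
  have htrm : reducedTrace ℚ D (σf γ t n m) = tOf t n m :=
    (trd_nrd_of_sq H.hγ (pos_of_mem_ellipticConductors H.hlt hmEC).ne' rfl (H.σf_sq hmEC)).1
  have hdm : tOf t n m ^ 2 - 4 * nOf t n m = v₀ ^ 2 + 4 * u₀ := by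
    have := sq_mul_disc H.hlt hmEC
    rw [← hdiscZ] at this
    exact mul_left_cancel₀ (pow_ne_zero 2 (by exact_mod_cast hm)) this
  obtain ⟨j, hj⟩ : ∃ j : ℤ, v₀ - tOf t n m = 2 * j := by
    have h2 : Even ((v₀ - tOf t n m) * (v₀ + tOf t n m)) := ⟨-2 * u₀ - 2 * nOf t n m, by linear_combination -hdm⟩
    rcases Int.even_mul.mp h2 with ⟨r, hr⟩ | ⟨r, hr⟩
    · exact ⟨r, by rw [hr]; ring⟩
    · exact ⟨r - tOf t n m, by linear_combination hr⟩
  have hdiff : σ₀ = σf γ t n m + ((j : ℤ) : D) := by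
    -- compare traces: `trd σ₀ = 2 r₀ + t/m`, `trd σ_m = 2k/m + t/m`
    have h1 : reducedTrace ℚ D σ₀ = 2 * r₀ + (m : ℚ)⁻¹ * t := by
      rw [hσ₀, reducedTrace_ratCoords, H.htr]
    have h2 : reducedTrace ℚ D (σf γ t n m) = 2 * ((shift t n : ℚ) / m) + (m : ℚ)⁻¹ * t := by
      unfold σf; rw [reducedTrace_ratCoords, H.htr]
    rw [htr0] at h1; rw [htrm] at h2
    have hr₀ : r₀ = (shift t n : ℚ) / m + j := by
      have e : ((v₀ : ℚ)) - (tOf t n m : ℚ) = 2 * (j : ℚ) := by exact_mod_cast hj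
      linear_combination (e - h1 + h2) / 2
    unfold σf
    rw [hσ₀, hr₀, map_add, ← map_intCast (algebraMap ℚ D) j]
    abel
  -- conclude `B = [1, σ₀] = [1, σ_m + j] = [1, σ_m]`
  have hBspan : B = Submodule.span ℤ {1, σ₀} := by
    ext b
    rw [hBσ, Submodule.mem_span_pair]
    constructor
    · rintro ⟨u, v, rfl⟩; exact ⟨u, v, by rw [Algebra.algebraMap_eq_smul_one, Int.cast_smul_eq_zsmul]⟩
    · rintro ⟨u, v, rfl⟩; exact ⟨u, v, by rw [Algebra.algebraMap_eq_smul_one, Int.cast_smul_eq_zsmul]⟩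
  rw [hBspan, hdiff, ordOf, span_one_add_int]

/-- **`f ↦ B_f` is injective on conductors.** [cite: Cox2013, §7.A (an order is determined by its conductor)] -/
theorem ordOf_injective {f g : ℕ} (hf : f ∈ ellipticConductors t n) (hg : g ∈ ellipticConductors t n)
    (h : ordOf γ t n f = ordOf γ t n g) : f = g := by
  have hf0 := pos_of_mem_ellipticConductors H.hlt hf
  have hg0 := pos_of_mem_ellipticConductors H.hlt hg
  -- `g ∣ f` from `σ_g ∈ B_f`, and symmetrically
  have key : ∀ {f g : ℕ}, 0 < f → 0 < g → σf γ t n g ∈ ordOf γ t n f → g ∣ f := by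
    intro f g hf0 hg0 hmem
    obtain ⟨u, v, huv⟩ := mem_ordOf_iff.mp hmem
    have e : algebraMap ℚ D ((shift t n : ℚ) / g) + ((g : ℚ))⁻¹ • γ =
        algebraMap ℚ D ((u : ℚ) + v * ((shift t n : ℚ) / f)) + ((v : ℚ) * ((f : ℚ))⁻¹) • γ := by
      unfold σf at huv
      rw [huv, smul_add, ← Int.cast_smul_eq_zsmul ℚ v, ← Int.cast_smul_eq_zsmul ℚ v, smul_smul,
        Algebra.smul_def (v : ℚ) (algebraMap ℚ D _), ← map_mul, map_add, add_assoc]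
    obtain ⟨-, h2⟩ := rat_coords_unique H.hγ e
    have hfQ : (f : ℚ) ≠ 0 := by exact_mod_cast hf0.ne'
    have hgQ : (g : ℚ) ≠ 0 := by exact_mod_cast hg0.ne'
    have : (f : ℚ) = v * g := by field_simp at h2; linear_combination h2
    have hZ : (f : ℤ) = v * g := by exact_mod_cast this
    exact Int.natCast_dvd_natCast.mp ⟨v, by rw [hZ]; ring⟩
  refine Nat.dvd_antisymm (key hg0 hf0 ?_) (key hf0 hg0 ?_)
  · rw [← h]; exact right_mem_span_pair _
  · rw [h]; exact right_mem_span_pair _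

end GammaHyp

end Orders


end Brandt

end Literature.NumberTheory.Automorphic

end
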